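import Mathlib
import Summits.KontsevichZagierPeriods.KontsevichZagierPeriods.Theorems.InverseLandauTateFamilyKernelQhPencilMulti
import Summits.KontsevichZagierPeriods.KontsevichZagierPeriods.Theorems.InverseLandauTateFamilyKernelOpenCube
import Summits.KontsevichZagierPeriods.KontsevichZagierPeriods.Theorems.InverseLandauTateFamilyKernelStubTowerBind
import Summits.KontsevichZagierPeriods.KontsevichZagierPeriods.Theorems.InverseLandauTateFamilyKernelStubPencilMoments
import Summits.KontsevichZagierPeriods.KontsevichZagierPeriods.Theorems.InverseLandauTateFamilyKernelStubQhFaceMoments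
import Summits.KontsevichZagierPeriods.KontsevichZagierPeriods.Theorems.InverseLandauTateFamilyKernelQhFacesExact
import Summits.KontsevichZagierPeriods.KontsevichZagierPeriods.Theorems.InverseLandauTateFamilyKernelQhFaceExactE

/-!
# Crux `TateFamilyKernel` (stmt-KontsevichZagierPeriods-9130), line `Sketch` — THE CLASS THEOREM of the Euler sector:
# `qhPencilMonotone_mem_relations` (wave 15 final glue, lead c4)

Quasi-homogeneous pencils `Q = 1 − ϖT` with monotone far faces and distinct far corners: every vanishing numerator gives
Kontsevich–Zagier relations at every real-algebraic fibre. Assembly of the line's landed pieces: the towers are built by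
recursion, `stub_towerBind` reparametrises them, `stub_pencilMoments` + `stub_qhFaceMoments` give the vanishing face moments,
`stub_qhFacesExact` makes both telescoped face families exact, `stub_qhFaceExactE` produces the tame primitive `E`, and
`qhPencilMulti_mem_relations_of_faceExact` (the multi-weight Euler telescoper) concludes. Mathlib + landed sibling files;
no named fact, no new definition.
-/

noncomputable section

open MeasureTheory Set MvPolynomial
open Literature.NumberTheory.Transcendental

namespace Summit.KontsevichZagierPeriods.InverseLandau.TateFamilyKernel.Descent


namespace QhPencilMonotone

/-- The far face `z₀ = 1` of `T` as a one-variable polynomial, pushed back into two variables: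
`τ_a(X₀) = T(1, X₀)`. [folklore] -/
theorem face_left_eq (T : MvPolynomial (Fin 2) ℚ) :
    Polynomial.aeval (X 0 : MvPolynomial (Fin 2) ℚ)
        (MvPolynomial.aeval (![Polynomial.C 1, Polynomial.X] : Fin 2 → Polynomial ℚ) T) =
      bind₁ ![C 1, X 0] T := by
  rw [← AlgHom.comp_apply, MvPolynomial.comp_aeval, ← aeval_eq_bind₁]
  congr 1
  ext i : 1
  fin_cases i <;> simp

/-- The far face `z₁ = 1` of `T`: `τ_b(X₀) = T(X₀, 1)`. [folklore] -/
theorem face_right_eq (T : MvPolynomial (Fin 2) ℚ) :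
    Polynomial.aeval (X 0 : MvPolynomial (Fin 2) ℚ)
        (MvPolynomial.aeval (![Polynomial.X, Polynomial.C 1] : Fin 2 → Polynomial ℚ) T) =
      bind₁ ![X 0, C 1] T := by
  rw [← AlgHom.comp_apply, MvPolynomial.comp_aeval, ← aeval_eq_bind₁]
  congr 1
  ext i : 1
  fin_cases i <;> simp

/-- Real values of the left face polynomial: `τ_a(s) = T(1,s)`. [folklore] -/
theorem aeval_face_left (T : MvPolynomial (Fin 2) ℚ) (s : ℝ) :
    Polynomial.aeval s (MvPolynomial.aeval (![Polynomial.C 1, Polynomial.X] : Fin 2 → Polynomial ℚ) T) =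
      aeval (![1, s] : Fin 2 → ℝ) T := by
  rw [← AlgHom.comp_apply, MvPolynomial.comp_aeval]
  congr 1
  ext i : 1
  fin_cases i <;> simp

/-- Real values of the right face polynomial: `τ_b(s) = T(s,1)`. [folklore] -/
theorem aeval_face_right (T : MvPolynomial (Fin 2) ℚ) (s : ℝ) :
    Polynomial.aeval s (MvPolynomial.aeval (![Polynomial.X, Polynomial.C 1] : Fin 2 → Polynomial ℚ) T) =
      aeval (![s, 1] : Fin 2 → ℝ) T := by
  rw [← AlgHom.comp_apply, MvPolynomial.comp_aeval]
  congr 1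
  ext i : 1
  fin_cases i <;> simp

/-- A polynomial that is strictly monotone on `[0,1]` (as a real function) is non-constant. [folklore] -/
theorem natDegree_pos_of_strictMonoOn (τ : Polynomial ℚ)
    (h : StrictMonoOn (fun s : ℝ => Polynomial.aeval s τ) (Icc 0 1)) : 0 < τ.natDegree := by
  by_contra h0
  have hdeg : τ.natDegree = 0 := Nat.eq_zero_of_not_pos h0
  obtain ⟨c, hc⟩ := Polynomial.natDegree_eq_zero.1 hdeg
  have h01 := h (left_mem_Icc.2 zero_le_one) (right_mem_Icc.2 zero_le_one) zero_lt_one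
  simp only [← hc, Polynomial.aeval_C] at h01
  exact lt_irrefl _ h01

/-- `|T|` is bounded on the closed square. [folklore] -/
theorem exists_bound_aeval (T : MvPolynomial (Fin 2) ℚ) : ∃ C : ℝ, 0 ≤ C ∧ ∀ z ∈ KZ.cube 2, |aeval z T| ≤ C := by
  obtain ⟨C, hC⟩ := KZ.isCompact_cube.exists_bound_of_continuousOn
    (f := fun z : Fin 2 → ℝ => aeval z T) (LinMoments.continuous_aeval T).continuousOn
  refine ⟨max C 0, le_max_right _ _, fun z hz => ?_⟩
  exact (Real.norm_eq_abs _ ▸ hC z hz).trans (le_max_left _ _)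

end QhPencilMonotone

/-- **THE CLASS THEOREM of the Euler sector (registered stub, tame-fibre form): quasi-homogeneous pencils with monotone faces and
distinct far corners — every vanishing numerator gives KZ relations.** For `T` weighted-homogeneous (weights `a,b`, degree `d ≥ 1`) whose
face restrictions `T(1,·)`, `T(·,1)` are positive and strictly increasing on `[0,1]` with `T(1,0) ≠ T(0,1)`, `P = Σ_{w∈W} P_w`
(`P_w` weighted-homogeneous of weight `w`, `w + a + b ≥ 1`), `1 − ϖT ≠ 0` on `[0,1]² × [0,ε)`, vanishing periods
`∫_{(0,1)²} P/(1 − ϖT) = 0` on `(0,ε)`, and a real-algebraic `ϖ₀ ∈ (0,ε)`: every tame cube representation of the fibre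
`P/(1 − ϖ₀T)` is a KZ relation. (Assembly: towers by recursion, `stub_towerBind`, `stub_pencilMoments`, `stub_qhFaceMoments`,
`stub_qhFacesExact`, `stub_qhFaceExactE`, `qhPencilMulti_mem_relations_of_faceExact`.) Covers all Brieskorn–Pham pencils
`c₁z₀^p + c₂z₁^q` with `c₁ ≠ c₂ > 0`. [cite: KontsevichZagier2001, §1.2] -/
theorem qhPencilMonotone_mem_relations (a b d : ℕ) (hd : 0 < d) (T : MvPolynomial (Fin 2) ℚ)
    (hT : T.IsWeightedHomogeneous (![a, b] : Fin 2 → ℕ) d) (W : Finset ℕ) (Pw : ℕ → MvPolynomial (Fin 2) ℚ)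
    (hPw : ∀ w ∈ W, (Pw w).IsWeightedHomogeneous (![a, b] : Fin 2 → ℕ) w) (hW : ∀ w ∈ W, 1 ≤ w + a + b)
    (ε ϖ₀ : ℝ) (halg : IsAlgebraic ℚ ϖ₀) (hϖ₀ : 0 < ϖ₀) (hϖ₀ε : ϖ₀ < ε)
    (hadm : ∀ z ∈ KZ.cube 2, ∀ ϖ ∈ Ico (0 : ℝ) ε, 1 - ϖ * aeval z T ≠ 0)
    (hvan : ∀ ϖ ∈ Ioo (0 : ℝ) ε, ∫ z in Set.pi Set.univ (fun _ : Fin 2 => Ioo (0 : ℝ) 1),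
      aeval z (∑ w ∈ W, Pw w) / (1 - ϖ * aeval z T) = 0)
    (hfa_pos : ∀ s ∈ Icc (0 : ℝ) 1, 0 < aeval (![1, s] : Fin 2 → ℝ) T)
    (hfb_pos : ∀ s ∈ Icc (0 : ℝ) 1, 0 < aeval (![s, 1] : Fin 2 → ℝ) T)
    (hfa_mono : StrictMonoOn (fun s : ℝ => aeval (![1, s] : Fin 2 → ℝ) T) (Icc 0 1))
    (hfb_mono : StrictMonoOn (fun s : ℝ => aeval (![s, 1] : Fin 2 → ℝ) T) (Icc 0 1))
    (hcorner : aeval (![1, 0] : Fin 2 → ℝ) T ≠ aeval (![0, 1] : Fin 2 → ℝ) T)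
    (Φ : KZ.IntegralRep 2) (hΦ : Φ.IsTameCube)
    (hΦi : ∀ z ∈ KZ.cube 2, Φ.integrand z =
      aeval (Fin.snoc z ϖ₀ : Fin (2 + 1) → ℝ) (rename Fin.castSucc (∑ w ∈ W, Pw w)) /
        aeval (Fin.snoc z ϖ₀ : Fin (2 + 1) → ℝ) (1 - X 2 * rename Fin.castSucc T)) :
    KZ.of Φ ∈ KZ.relations := by
  classical
  -- the empty family: the integrand vanishes
  rcases W.eq_empty_or_nonempty with hWe | hWne
  · subst hWe
    refine KZ.of_mem_relations_of_eqOn_zero Φ fun z hz => ?_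
    rw [hΦ.domain_eq] at hz
    rw [hΦi z hz, Finset.sum_empty, map_zero, map_zero, zero_div, Pi.zero_apply]
  -- the face polynomials `τ_a(s) = T(1,s)`, `τ_b(s) = T(s,1)`
  set τa : Polynomial ℚ := MvPolynomial.aeval (![Polynomial.C 1, Polynomial.X] : Fin 2 → Polynomial ℚ) T
    with hτa_def
  set τb : Polynomial ℚ := MvPolynomial.aeval (![Polynomial.X, Polynomial.C 1] : Fin 2 → Polynomial ℚ) T
    with hτb_def
  have hτaT : Polynomial.aeval (X 0 : MvPolynomial (Fin 2) ℚ) τa = bind₁ ![C 1, X 0] T :=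
    QhPencilMonotone.face_left_eq T
  have hτbT : Polynomial.aeval (X 0 : MvPolynomial (Fin 2) ℚ) τb = bind₁ ![X 0, C 1] T :=
    QhPencilMonotone.face_right_eq T
  have hτa_real : ∀ s : ℝ, Polynomial.aeval s τa = aeval (![1, s] : Fin 2 → ℝ) T :=
    QhPencilMonotone.aeval_face_left T
  have hτb_real : ∀ s : ℝ, Polynomial.aeval s τb = aeval (![s, 1] : Fin 2 → ℝ) T :=
    QhPencilMonotone.aeval_face_right T
  have hτa : ∀ s ∈ Icc (0 : ℝ) 1, 0 < Polynomial.aeval s τa := fun s hs => by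
    rw [hτa_real]; exact hfa_pos s hs
  have hτb : ∀ s ∈ Icc (0 : ℝ) 1, 0 < Polynomial.aeval s τb := fun s hs => by
    rw [hτb_real]; exact hfb_pos s hs
  have hma : StrictMonoOn (fun s : ℝ => Polynomial.aeval s τa) (Icc 0 1) := by
    have : (fun s : ℝ => Polynomial.aeval s τa) = fun s => aeval (![1, s] : Fin 2 → ℝ) T := funext hτa_real
    rw [this]; exact hfa_mono
  have hmb : StrictMonoOn (fun s : ℝ => Polynomial.aeval s τb) (Icc 0 1) := by
    have : (fun s : ℝ => Polynomial.aeval s τb) = fun s => aeval (![s, 1] : Fin 2 → ℝ) T := funext hτb_real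
    rw [this]; exact hfb_mono
  have hdega : 0 < τa.natDegree := QhPencilMonotone.natDegree_pos_of_strictMonoOn τa hma
  have hdegb : 0 < τb.natDegree := QhPencilMonotone.natDegree_pos_of_strictMonoOn τb hmb
  have hcorner' : Polynomial.aeval (0 : ℝ) τa ≠ Polynomial.aeval (0 : ℝ) τb := by
    rw [hτa_real, hτb_real]; exact hcorner
  -- the towers at the `(s,ϖ)`-level, by recursion
  set Da2 : MvPolynomial (Fin (1 + 1)) ℚ := 1 - X 1 * bind₁ ![C 1, X 0] T with hDa2
  set Db2 : MvPolynomial (Fin (1 + 1)) ℚ := 1 - X 1 * bind₁ ![X 0, C 1] T with hDb2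
  let NAs : ℕ → ℕ → MvPolynomial (Fin (1 + 1)) ℚ := fun w i =>
    Nat.rec (motive := fun _ => MvPolynomial (Fin (1 + 1)) ℚ) (C (a : ℚ) * bind₁ ![C 1, X 0] (Pw w))
      (fun j N => X 1 * (pderiv 1 N * Da2 - C ((j : ℚ) + 1) * N * pderiv 1 Da2)) i
  let NBs : ℕ → ℕ → MvPolynomial (Fin (1 + 1)) ℚ := fun w i =>
    Nat.rec (motive := fun _ => MvPolynomial (Fin (1 + 1)) ℚ) (C (b : ℚ) * bind₁ ![X 0, C 1] (Pw w))
      (fun j N => X 1 * (pderiv 1 N * Db2 - C ((j : ℚ) + 1) * N * pderiv 1 Db2)) i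
  let Ns : ℕ → ℕ → MvPolynomial (Fin (1 + 1)) ℚ := fun w i =>
    Nat.rec (motive := fun _ => MvPolynomial (Fin (1 + 1)) ℚ)
      (C (a : ℚ) * bind₁ ![C 1, X 0] (Pw w) * Db2 + C (b : ℚ) * bind₁ ![X 0, C 1] (Pw w) * Da2)
      (fun j N => X 1 * (pderiv 1 N * (Da2 * Db2) - C ((j : ℚ) + 1) * N * pderiv 1 (Da2 * Db2))) i
  have hNA0 : ∀ w, NAs w 0 = C (a : ℚ) * bind₁ ![C 1, X 0] (Pw w) := fun w => rfl
  have hNAS : ∀ w i, NAs w (i + 1) =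
      X 1 * (pderiv 1 (NAs w i) * (1 - X 1 * bind₁ ![C 1, X 0] T) -
        C ((i : ℚ) + 1) * NAs w i * pderiv 1 (1 - X 1 * bind₁ ![C 1, X 0] T)) := fun w i => rfl
  have hNB0 : ∀ w, NBs w 0 = C (b : ℚ) * bind₁ ![X 0, C 1] (Pw w) := fun w => rfl
  have hNBS : ∀ w i, NBs w (i + 1) =
      X 1 * (pderiv 1 (NBs w i) * (1 - X 1 * bind₁ ![X 0, C 1] T) -
        C ((i : ℚ) + 1) * NBs w i * pderiv 1 (1 - X 1 * bind₁ ![X 0, C 1] T)) := fun w i => rfl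
  have hNs0 : ∀ w, Ns w 0 =
      C (a : ℚ) * bind₁ ![C 1, X 0] (Pw w) * (1 - X 1 * bind₁ ![X 0, C 1] T) +
        C (b : ℚ) * bind₁ ![X 0, C 1] (Pw w) * (1 - X 1 * bind₁ ![C 1, X 0] T) := fun w => rfl
  have hNsS : ∀ w i, Ns w (i + 1) =
      X 1 * (pderiv 1 (Ns w i) * ((1 - X 1 * bind₁ ![C 1, X 0] T) * (1 - X 1 * bind₁ ![X 0, C 1] T)) -
        C ((i : ℚ) + 1) * Ns w i *
          pderiv 1 ((1 - X 1 * bind₁ ![C 1, X 0] T) * (1 - X 1 * bind₁ ![X 0, C 1] T))) := fun w i => rfl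
  -- vanishing moments and face moments
  obtain ⟨CT, hCT0, hCT⟩ := QhPencilMonotone.exists_bound_aeval T
  have hε : 0 < ε := hϖ₀.trans hϖ₀ε
  set bm : ℝ := min ε (1 / (CT + 1)) with hbm
  have hbm0 : 0 < bm := lt_min hε (by positivity)
  have hTb : ∀ z ∈ KZ.cube 2, |aeval z T| * bm ≤ 1 := by
    intro z hz
    have h1 : bm ≤ 1 / (CT + 1) := min_le_right _ _
    have h2 : |aeval z T| ≤ CT := hCT z hz
    calc |aeval z T| * bm ≤ CT * (1 / (CT + 1)) :=
          mul_le_mul h2 h1 hbm0.le hCT0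
      _ ≤ 1 := by
          rw [mul_one_div, div_le_one (by positivity)]; linarith
  have hvanb : ∀ ϖ ∈ Ioo (0 : ℝ) bm, ∫ z in Set.pi Set.univ (fun _ : Fin 2 => Ioo (0 : ℝ) 1),
      aeval z (∑ w ∈ W, Pw w) / (1 - ϖ * aeval z T) = 0 := fun ϖ hϖ =>
    hvan ϖ ⟨hϖ.1, hϖ.2.trans_le (min_le_left _ _)⟩
  have hmom := stub_pencilMoments T (∑ w ∈ W, Pw w) bm hbm0 hTb hvanb
  have hmomf := stub_qhFaceMoments a b d T hT W Pw hPw hmom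
  -- exact faces
  obtain ⟨ca, cb, Ma, Mb, b₁, hca, hcb, hb₁, hHab, hfv⟩ :=
    stub_qhFacesExact a b d T W hWne Pw NAs NBs hNA0 hNAS hNB0 hNBS hmomf τa τb hτaT hτbT hdega hdegb
      hτa hτb hma hmb hcorner'
  -- admissibility on the band `[0,1] × [0,ϖ₀]` of the two faces
  have hband : ∀ s ∈ Icc (0 : ℝ) 1, ∀ ϖ ∈ Icc (0 : ℝ) ϖ₀,
      1 - ϖ * Polynomial.aeval s τa ≠ 0 ∧ 1 - ϖ * Polynomial.aeval s τb ≠ 0 := by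
    intro s hs ϖ hϖ
    have hϖ' : ϖ ∈ Ico (0 : ℝ) ε := ⟨hϖ.1, hϖ.2.trans_lt hϖ₀ε⟩
    refine ⟨?_, ?_⟩
    · rw [hτa_real]
      exact hadm _ (QhPencil.vec_mem_cube_two ⟨zero_le_one, le_rfl⟩ hs) ϖ hϖ'
    · rw [hτb_real]
      exact hadm _ (QhPencil.vec_mem_cube_two hs ⟨zero_le_one, le_rfl⟩) ϖ hϖ'
  -- the tame primitive of the telescoped face family
  set b₂ : ℝ := min b₁ ϖ₀ with hb₂
  have hb₂0 : 0 < b₂ := lt_min hb₁ hϖ₀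
  have hfv' := fun ϖ (hϖ : ϖ ∈ Ioo (0 : ℝ) b₂) => hfv ϖ ⟨hϖ.1, hϖ.2.trans_le (min_le_left _ _)⟩
  obtain ⟨E, hEa, hEs, hE, hE01⟩ :=
    stub_qhFaceExactE a b d T W hWne Pw Ns hNs0 hNsS NAs NBs hNA0 hNAS hNB0 hNBS τa τb hτaT hτbT ca cb Ma Mb
      hca hcb hHab ϖ₀ halg hϖ₀ hband b₂ hb₂0 (min_le_right _ _) hfv'
  -- the reparametrised tower and the multi-weight Euler telescoper
  obtain ⟨hM0, hMS⟩ := stub_towerBind a b d T Pw Ns hNs0 hNsS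
  have hadm' : ∀ z ∈ KZ.cube 2, ∀ ϖ ∈ Icc (0 : ℝ) ϖ₀, 1 - ϖ * aeval z T ≠ 0 := fun z hz ϖ hϖ =>
    hadm z hz ϖ ⟨hϖ.1, hϖ.2.trans_lt hϖ₀ε⟩
  exact qhPencilMulti_mem_relations_of_faceExact a b d hd T hT W Pw hPw hW ϖ₀ halg hϖ₀ hadm'
    (fun w i => C ((d : ℚ) ^ i) * bind₁ ![X 0, X 2 * X 1 ^ d] (Ns w i)) hM0 hMS E hEa hEs hE hE01 Φ hΦ hΦi

/-- **The class theorem on the honest open square.** Same hypotheses as `qhPencilMonotone_mem_relations`; conclusion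
for every representation over the open unit square `(0,1)²` whose integrand agrees there with `P/(1 − ϖ₀T)` — the
format of the crux `TateFamilyKernel` (tame fibre via `exists_isTameCube_fibre`, bridge `of_mem_relations_of_isTameCube`).
[cite: KontsevichZagier2001, §1.2] -/
theorem qhPencilMonotone_openCube_mem_relations (a b d : ℕ) (hd : 0 < d) (T : MvPolynomial (Fin 2) ℚ)
    (hT : T.IsWeightedHomogeneous (![a, b] : Fin 2 → ℕ) d) (W : Finset ℕ) (Pw : ℕ → MvPolynomial (Fin 2) ℚ)
    (hPw : ∀ w ∈ W, (Pw w).IsWeightedHomogeneous (![a, b] : Fin 2 → ℕ) w) (hW : ∀ w ∈ W, 1 ≤ w + a + b)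
    (ε ϖ₀ : ℝ) (halg : IsAlgebraic ℚ ϖ₀) (hϖ₀ : 0 < ϖ₀) (hϖ₀ε : ϖ₀ < ε)
    (hadm : ∀ z ∈ KZ.cube 2, ∀ ϖ ∈ Ico (0 : ℝ) ε, 1 - ϖ * aeval z T ≠ 0)
    (hvan : ∀ ϖ ∈ Ioo (0 : ℝ) ε, ∫ z in Set.pi Set.univ (fun _ : Fin 2 => Ioo (0 : ℝ) 1),
      aeval z (∑ w ∈ W, Pw w) / (1 - ϖ * aeval z T) = 0)
    (hfa_pos : ∀ s ∈ Icc (0 : ℝ) 1, 0 < aeval (![1, s] : Fin 2 → ℝ) T)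
    (hfb_pos : ∀ s ∈ Icc (0 : ℝ) 1, 0 < aeval (![s, 1] : Fin 2 → ℝ) T)
    (hfa_mono : StrictMonoOn (fun s : ℝ => aeval (![1, s] : Fin 2 → ℝ) T) (Icc 0 1))
    (hfb_mono : StrictMonoOn (fun s : ℝ => aeval (![s, 1] : Fin 2 → ℝ) T) (Icc 0 1))
    (hcorner : aeval (![1, 0] : Fin 2 → ℝ) T ≠ aeval (![0, 1] : Fin 2 → ℝ) T)
    (r : KZ.IntegralRep 2) (hrd : r.domain = Set.pi Set.univ (fun _ : Fin 2 => Ioo (0 : ℝ) 1))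
    (hri : EqOn r.integrand (fun z => aeval z (∑ w ∈ W, Pw w) / (1 - ϖ₀ * aeval z T)) r.domain) :
    KZ.of r ∈ KZ.relations := by
  have hadm' : ∀ z ∈ KZ.cube 2, ∀ ϖ ∈ Icc (0 : ℝ) ϖ₀, 1 - ϖ * aeval z T ≠ 0 := fun z hz ϖ hϖ =>
    hadm z hz ϖ ⟨hϖ.1, hϖ.2.trans_lt hϖ₀ε⟩
  have hQ : ∀ z ∈ KZ.cube 2, aeval (Fin.snoc z ϖ₀ : Fin (2 + 1) → ℝ) (1 - X 2 * rename Fin.castSucc T) ≠ 0 :=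
    QhPencilMulti.adm_fibre hϖ₀ hadm'
  have hfib : ∀ z : Fin 2 → ℝ,
      aeval (Fin.snoc z ϖ₀ : Fin (2 + 1) → ℝ) (rename Fin.castSucc (∑ w ∈ W, Pw w)) /
          aeval (Fin.snoc z ϖ₀ : Fin (2 + 1) → ℝ) (1 - X 2 * rename Fin.castSucc T) =
        aeval z (∑ w ∈ W, Pw w) / (1 - ϖ₀ * aeval z T) := fun z => by
    simp only [map_sub, map_mul, map_one, aeval_X, EulerDivergence.snoc_apply_two,
      LinMoments.aeval_snoc_rename_castSucc]
  obtain ⟨Ψ, hΨ, hΨi⟩ := exists_isTameCube_fibre (rename Fin.castSucc (∑ w ∈ W, Pw w)) _ halg hQ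
  have hΨrel : KZ.of Ψ ∈ KZ.relations :=
    qhPencilMonotone_mem_relations a b d hd T hT W Pw hPw hW ε ϖ₀ halg hϖ₀ hϖ₀ε hadm hvan hfa_pos hfb_pos
      hfa_mono hfb_mono hcorner Ψ hΨ (fun z _ => by rw [hΨi])
  exact of_mem_relations_of_isTameCube hΨ hΨrel r hrd
    (fun z hz => by rw [hΨi]; exact (hri hz).trans (hfib z).symm)

/-- **Brieskorn–Pham pencils** `Q = 1 − ϖ(c₁z₀^p + c₂z₁^q)`, `c₁ ≠ c₂ > 0`, `p, q ≥ 1` (polar curves of genus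
`(p−1)(q−1)/2`): every vanishing weighted numerator gives KZ relations at every real-algebraic fibre — an instance of
`qhPencilMonotone_openCube_mem_relations` with weights `(q, p)`, degree `pq`; the faces `c₁ + c₂s^q`, `c₁s^p + c₂` are
positive and strictly increasing on `[0,1]` and the far corners `c₁ ≠ c₂` differ. [cite: KontsevichZagier2001, §1.2] -/
theorem brieskornPham_openCube_mem_relations (p q : ℕ) (hp : 0 < p) (hq : 0 < q) (c₁ c₂ : ℚ)
    (hc₁ : 0 < c₁) (hc₂ : 0 < c₂) (hne : c₁ ≠ c₂) (W : Finset ℕ) (Pw : ℕ → MvPolynomial (Fin 2) ℚ)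
    (hPw : ∀ w ∈ W, (Pw w).IsWeightedHomogeneous (![q, p] : Fin 2 → ℕ) w)
    (ε ϖ₀ : ℝ) (halg : IsAlgebraic ℚ ϖ₀) (hϖ₀ : 0 < ϖ₀) (hϖ₀ε : ϖ₀ < ε)
    (hadm : ∀ z ∈ KZ.cube 2, ∀ ϖ ∈ Ico (0 : ℝ) ε,
      1 - ϖ * aeval z (C c₁ * X 0 ^ p + C c₂ * X 1 ^ q : MvPolynomial (Fin 2) ℚ) ≠ 0)
    (hvan : ∀ ϖ ∈ Ioo (0 : ℝ) ε, ∫ z in Set.pi Set.univ (fun _ : Fin 2 => Ioo (0 : ℝ) 1),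
      aeval z (∑ w ∈ W, Pw w) / (1 - ϖ * aeval z (C c₁ * X 0 ^ p + C c₂ * X 1 ^ q : MvPolynomial (Fin 2) ℚ)) = 0)
    (r : KZ.IntegralRep 2) (hrd : r.domain = Set.pi Set.univ (fun _ : Fin 2 => Ioo (0 : ℝ) 1))
    (hri : EqOn r.integrand (fun z => aeval z (∑ w ∈ W, Pw w) /
      (1 - ϖ₀ * aeval z (C c₁ * X 0 ^ p + C c₂ * X 1 ^ q : MvPolynomial (Fin 2) ℚ))) r.domain) :
    KZ.of r ∈ KZ.relations := by
  set T : MvPolynomial (Fin 2) ℚ := C c₁ * X 0 ^ p + C c₂ * X 1 ^ q with hTdef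
  -- weighted homogeneity, weights `(q, p)`, degree `pq`
  have hT : T.IsWeightedHomogeneous (![q, p] : Fin 2 → ℕ) (p * q) := by
    have h0 : IsWeightedHomogeneous (![q, p] : Fin 2 → ℕ) (C c₁ * X 0 ^ p : MvPolynomial (Fin 2) ℚ) (p * q) := by
      rw [C_mul_X_pow_eq_monomial]
      exact isWeightedHomogeneous_monomial _ _ _ (by simp [Finsupp.weight_apply])
    have h1 : IsWeightedHomogeneous (![q, p] : Fin 2 → ℕ) (C c₂ * X 1 ^ q : MvPolynomial (Fin 2) ℚ) (p * q) := by
      rw [C_mul_X_pow_eq_monomial]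
      exact isWeightedHomogeneous_monomial _ _ _ (by simp [Finsupp.weight_apply, mul_comm])
    exact h0.add h1
  -- the two far faces
  have hfa : ∀ s : ℝ, aeval (![1, s] : Fin 2 → ℝ) T = (c₁ : ℝ) + c₂ * s ^ q := fun s => by
    simp [hTdef]
  have hfb : ∀ s : ℝ, aeval (![s, 1] : Fin 2 → ℝ) T = (c₁ : ℝ) * s ^ p + c₂ := fun s => by
    simp [hTdef]
  have hc₁' : (0 : ℝ) < c₁ := by exact_mod_cast hc₁
  have hc₂' : (0 : ℝ) < c₂ := by exact_mod_cast hc₂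
  refine qhPencilMonotone_openCube_mem_relations q p (p * q) (Nat.mul_pos hp hq) T hT W Pw hPw
    (fun w _ => by omega) ε ϖ₀ halg hϖ₀ hϖ₀ε hadm hvan (fun s hs => ?_) (fun s hs => ?_) ?_ ?_ ?_ r hrd hri
  · rw [hfa]; have := pow_nonneg hs.1 q; positivity
  · rw [hfb]; have := pow_nonneg hs.1 p; positivity
  · intro s hs t ht hst
    simp only [hfa]
    have := pow_lt_pow_left₀ hst hs.1 hq.ne'
    nlinarith
  · intro s hs t ht hst
    simp only [hfb]
    have := pow_lt_pow_left₀ hst hs.1 hp.ne'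
    nlinarith
  · rw [hfa, hfb, zero_pow hq.ne', zero_pow hp.ne', mul_zero, add_zero, mul_zero, zero_add]
    exact_mod_cast hne

end Summit.KontsevichZagierPeriods.InverseLandau.TateFamilyKernel.Descent

end
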